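import Literature.AlgebraicTopology.Homotopy.FibreBundlesCubes
import Mathlib.Analysis.SpecialFunctions.Trigonometric.Arctan
import HarnessLib

/-!
# Fibre bundles over the line and over open intervals are trivial

Third proof file of `FibreBundles.lean` (all PROVED, no named fact). `FibreBundlesCubes.lean`
trivialises fibre bundles over compact cubes `Iⁿ` (`IsFibreBundleWith.exists_homeomorph_prod_of_cube`);
this file passes to the NON-compact base `ℝ` (and every base homeomorphic to it, in particular open
intervals `(a, b)`), by exhaustion:

* `IsFibreBundleWith.comp_homeomorph_base` — transport of a fibre bundle along a homeomorphism of
  the base.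
* `IsFibreBundleWith.IsPartialTriv q K Φ Ψ` — a *partial trivialisation* of `q : E → ℝ` over
  `K ⊆ ℝ`, recorded as in `FibreBundlesCubes` by total functions `Φ : ℝ × F → E` (chart) and
  `Ψ : E → F` (fibre coordinate), continuous on `K × F` resp. `q⁻¹ K`, with `q (Φ (x, f)) = x`,
  `Ψ (Φ (x, f)) = f` for `x ∈ K` and `Φ (q y, Ψ y) = y` for `q y ∈ K`.
* `exists_isPartialTriv_Icc` — a partial trivialisation over every compact interval `[a, b]`
  (the cube theorem for `n = 1`, transported along `[a, b] ≃ₜ I¹`, extended off `[a, b]` by the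
  projection `projIcc`).
* `exists_isPartialTriv_extend` — **extension with agreement**: a partial trivialisation over
  `[a, b]` extends to one over any bigger `[a', b']` which AGREES with it over `[a, b]` — correct an
  arbitrary partial trivialisation `(Φ₂, Ψ₂)` over `[a', b']` by the transition function at the
  retracted base point, `Φ'(x, f) = Φ₂ (x, Ψ₂ (Φ (r x, f)))`, `r = projIcc a b` (Steenrod 1951,
  §11.6; Hatcher 2002, proof of Prop. 4.48).
* `exists_homeomorph_prod_of_real` — **a fibre bundle over `ℝ` is trivial**: iterate the extension
  over `[-n-1, n+1]`, `n : ℕ`, and take the union (the partial trivialisations are eventually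
  constant near every point, so the limit is continuous).
* `exists_homeomorph_prod_of_homeomorph_real`, `iooHomeomorphReal`, `exists_homeomorph_prod_of_Ioo`,
  `exists_homeomorph_prod_of_Ioi` — the same for any base homeomorphic to `ℝ`, e.g. an open interval
  (`tan` after an affine map) or an open half-line (`log` after a translation).

This is the classical "bundles over contractible (here: exhaustible-by-cubes) bases are trivial"
(Steenrod, *The Topology of Fibre Bundles*, §11.4–§11.6, Cor. 11.6; Husemoller, *Fibre Bundles*,
Ch. 2 §7 and Ch. 4 Cor. 10.3) in the structure-group-free setting of `IsFibreBundleWith`. It is the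
step turning Ehresmann's LOCAL triviality of a proper submersion onto an interval into the GLOBAL
product structure over `(0, ε)` consumed by the collar squeeze
`Literature.AlgebraicGeometry.HodgeTheory.exists_squeeze_of_trivialization`.

## References

* N. Steenrod, *The Topology of Fibre Bundles*, Princeton (1951), §11.4–§11.6. [Steenrod1951]
* A. Hatcher, *Algebraic Topology*, CUP (2002), §4.2, proof of Prop. 4.48. [HatcherAT2002]
* D. Husemoller, *Fibre Bundles*, 3rd ed., GTM 20 (1994), Ch. 2, Cor. 6.7; Ch. 4, Cor. 10.3.
  [HusemollerFibreBundles1994]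
-/

noncomputable section

open scoped unitInterval
open Function Set Filter
open _root_.Topology

namespace Literature.AlgebraicTopology.Homotopy

universe u v w u'

namespace IsFibreBundleWith

/-! ### Transport along a homeomorphism of the base -/

section Base

variable {E : Type u} {B : Type v} {F : Type w} [TopologicalSpace E] [TopologicalSpace B]
  [TopologicalSpace F] {p : E → B}

/-- A fibre bundle followed by a homeomorphism of the base is a fibre bundle with the same fibre.
[folklore] -/
theorem comp_homeomorph_base {B' : Type u'} [TopologicalSpace B'] (h : IsFibreBundleWith F p)
    (β : B ≃ₜ B') : IsFibreBundleWith F (β ∘ p) := by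
  refine ⟨β.continuous.comp h.continuous, fun b' => ?_⟩
  obtain ⟨U, hU, hbU, e, he⟩ := h.2 (β.symm b')
  have hset : (β ∘ p) ⁻¹' (β.symm ⁻¹' U) = p ⁻¹' U := by
    ext x
    simp
  let e₁ : ↥((β ∘ p) ⁻¹' (β.symm ⁻¹' U)) ≃ₜ ↥(p ⁻¹' U) := Homeomorph.setCongr hset
  have hU' : β '' U = β.symm ⁻¹' U := by
    ext y
    constructor
    · rintro ⟨x, hx, rfl⟩
      simpa using hx
    · intro hy
      exact ⟨β.symm y, hy, β.apply_symm_apply y⟩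
  let e₃ : ↥U ≃ₜ ↥(β.symm ⁻¹' U) := (β.image U).trans (Homeomorph.setCongr hU')
  refine ⟨β.symm ⁻¹' U, hU.preimage β.symm.continuous, hbU,
    e₁.trans (e.trans (e₃.prodCongr (Homeomorph.refl F))), fun z => ?_⟩
  change β ((e (e₁ z)).1 : B) = β (p z)
  rw [he]
  rfl

end Base

/-! ### Partial trivialisations over subsets of `ℝ` -/

section Partial

variable {E : Type u} {F : Type w} [TopologicalSpace E] [TopologicalSpace F] {q : E → ℝ}

/-- A **partial trivialisation** of `q : E → ℝ` over `K ⊆ ℝ`: a chart `Φ : ℝ × F → E` and a fibre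
coordinate `Ψ : E → F` (total functions), continuous on `K × F` resp. `q⁻¹ K`, inverse to each
other over `K`. [cite: Steenrod1951, §11.4] -/
structure IsPartialTriv (q : E → ℝ) (K : Set ℝ) (Φ : ℝ × F → E) (Ψ : E → F) : Prop where
  /-- the chart is continuous on `K × F` -/
  continuousOn_chart : ContinuousOn Φ (K ×ˢ univ)
  /-- the fibre coordinate is continuous on `q⁻¹ K` -/
  continuousOn_coord : ContinuousOn Ψ (q ⁻¹' K)
  /-- the chart is fibrewise -/
  proj_chart : ∀ x ∈ K, ∀ f, q (Φ (x, f)) = x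
  /-- the fibre coordinate of the chart -/
  coord_chart : ∀ x ∈ K, ∀ f, Ψ (Φ (x, f)) = f
  /-- the chart recovers the point from its base point and fibre coordinate -/
  chart_proj_coord : ∀ y, q y ∈ K → Φ (q y, Ψ y) = y

/-- Partial trivialisations restrict to smaller subsets. [folklore] -/
theorem IsPartialTriv.mono {K K' : Set ℝ} {Φ : ℝ × F → E} {Ψ : E → F} (h : IsPartialTriv q K Φ Ψ)
    (hK : K' ⊆ K) : IsPartialTriv q K' Φ Ψ where
  continuousOn_chart := h.continuousOn_chart.mono (prod_mono hK Subset.rfl)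
  continuousOn_coord := h.continuousOn_coord.mono (preimage_mono hK)
  proj_chart x hx f := h.proj_chart x (hK hx) f
  coord_chart x hx f := h.coord_chart x (hK hx) f
  chart_proj_coord y hy := h.chart_proj_coord y (hK hy)

/-- The affine homeomorphism `[a, b] ≃ₜ I` (`a < b`). [folklore] -/
def iccHomeomorphUnitInterval {a b : ℝ} (hab : a < b) : Icc a b ≃ₜ I where
  toFun x := ⟨(x - a) / (b - a), by
    constructor
    · exact div_nonneg (by linarith [x.2.1]) (by linarith)
    · rw [div_le_one (by linarith)]; linarith [x.2.2]⟩
  invFun t := ⟨a + t * (b - a), by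
    constructor
    · nlinarith [t.2.1, t.2.2]
    · nlinarith [t.2.1, t.2.2]⟩
  left_inv x := by
    apply Subtype.ext
    have hba : b - a ≠ 0 := by linarith
    show a + (x - a) / (b - a) * (b - a) = x
    field_simp
    ring
  right_inv t := by
    apply Subtype.ext
    have hba : b - a ≠ 0 := by linarith
    show (a + t * (b - a) - a) / (b - a) = t
    field_simp
    ring
  continuous_toFun := by
    refine Continuous.subtype_mk ?_ _
    exact (continuous_subtype_val.sub continuous_const).div_const _
  continuous_invFun := by
    refine Continuous.subtype_mk ?_ _
    exact continuous_const.add (continuous_subtype_val.mul continuous_const)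

/-- **A partial trivialisation over a compact interval** (the cube theorem, `n = 1`). [folklore] -/
theorem exists_isPartialTriv_Icc [Nonempty E] (hq : IsFibreBundleWith F q) {a b : ℝ} (hab : a < b) :
    ∃ (Φ : ℝ × F → E) (Ψ : E → F), IsPartialTriv q (Icc a b) Φ Ψ := by
  classical
  set K : Set ℝ := Icc a b with hK
  -- a point of `F`
  obtain ⟨y₀⟩ := ‹Nonempty E›
  obtain ⟨g⟩ := hq.nonempty_fibre_homeomorph (q y₀)
  let f₀ : F := g ⟨y₀, rfl⟩
  -- the bundle over `K`, with base identified with the cube `I¹`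
  let β : ↥K ≃ₜ (Fin 1 → I) :=
    (iccHomeomorphUnitInterval hab).trans (Homeomorph.funUnique (Fin 1) I).symm
  have hK' : IsFibreBundleWith F (β ∘ K.restrictPreimage q) :=
    (hq.restrictPreimage K).comp_homeomorph_base β
  obtain ⟨e, he⟩ := exists_homeomorph_prod_of_cube hK'
  have heq : ∀ y : ↥(q ⁻¹' K), β.symm (e y).1 = ⟨q y, y.2⟩ := fun y => by
    rw [he]
    exact β.symm_apply_apply _
  -- total functions: extend the base coordinate by `projIcc`
  let Φ : ℝ × F → E := fun z => (e.symm (β (projIcc a b hab.le z.1), z.2) : E)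
  let Ψ : E → F := fun y => if hy : q y ∈ K then (e ⟨y, hy⟩).2 else f₀
  have hΨ : ∀ (y : E) (hy : q y ∈ K), Ψ y = (e ⟨y, hy⟩).2 := fun y hy => dif_pos hy
  refine ⟨Φ, Ψ, ⟨?_, ?_, ?_, ?_, ?_⟩⟩
  · -- continuity of the chart (everywhere)
    refine Continuous.continuousOn ?_
    exact continuous_subtype_val.comp (e.symm.continuous.comp
      ((β.continuous.comp (continuous_projIcc.comp continuous_fst)).prodMk continuous_snd))
  · -- continuity of the fibre coordinate on `q⁻¹ K`
    rw [continuousOn_iff_continuous_restrict]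
    have h1 : (q ⁻¹' K).restrict Ψ = fun y : ↥(q ⁻¹' K) => (e y).2 := by
      funext y
      exact hΨ y y.2
    rw [h1]
    exact continuous_snd.comp e.continuous
  · -- `q (Φ (x, f)) = x`
    intro x hx f
    show q (e.symm (β (projIcc a b hab.le x), f) : E) = x
    rw [projIcc_of_mem hab.le hx]
    have h1 := heq (e.symm (β ⟨x, hx⟩, f))
    rw [Homeomorph.apply_symm_apply, β.symm_apply_apply] at h1
    exact (congrArg Subtype.val h1).symm
  · -- `Ψ (Φ (x, f)) = f`
    intro x hx f
    show Ψ (e.symm (β (projIcc a b hab.le x), f) : E) = f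
    rw [hΨ _ (e.symm (β (projIcc a b hab.le x), f)).2, Subtype.coe_eta, Homeomorph.apply_symm_apply]
  · -- `Φ (q y, Ψ y) = y`
    intro y hy
    show (e.symm (β (projIcc a b hab.le (q y)), Ψ y) : E) = y
    rw [hΨ y hy, projIcc_of_mem hab.le hy]
    have h1 : β ⟨q y, hy⟩ = (e ⟨y, hy⟩).1 := by
      rw [← heq ⟨y, hy⟩, Homeomorph.apply_symm_apply]
    rw [h1, Prod.mk.eta, Homeomorph.symm_apply_apply]

/-- **Extension with agreement.** A partial trivialisation `(Φ, Ψ)` over `[a, b]` extends to a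
partial trivialisation `(Φ', Ψ')` over any `[a', b'] ⊇ [a, b]` with `Φ' = Φ` on `[a, b] × F` and
`Ψ' = Ψ` on `q⁻¹ [a, b]`: take any `(Φ₂, Ψ₂)` over `[a', b']` and correct it by the transition
function at the retracted base point `r x` (`r = projIcc a b`):
`Φ' (x, f) = Φ₂ (x, Ψ₂ (Φ (r x, f)))`, `Ψ' y = Ψ (Φ₂ (r (q y), Ψ₂ y))` (Steenrod 1951, §11.6;
Hatcher 2002, proof of Prop. 4.48). [cite: HatcherAT2002, Prop. 4.48 (proof)] -/
theorem exists_isPartialTriv_extend [Nonempty E] (hq : IsFibreBundleWith F q) {a b a' b' : ℝ}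
    (hab : a < b) (ha : a' ≤ a) (hb : b ≤ b') {Φ : ℝ × F → E} {Ψ : E → F}
    (hT : IsPartialTriv q (Icc a b) Φ Ψ) :
    ∃ T' : (ℝ × F → E) × (E → F), IsPartialTriv q (Icc a' b') T'.1 T'.2 ∧
      (∀ x ∈ Icc a b, ∀ f, T'.1 (x, f) = Φ (x, f)) ∧ ∀ y, q y ∈ Icc a b → T'.2 y = Ψ y := by
  have hab' : a' < b' := lt_of_le_of_lt ha (lt_of_lt_of_le hab hb)
  have hsub : Icc a b ⊆ Icc a' b' := Icc_subset_Icc ha hb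
  obtain ⟨Φ₂, Ψ₂, hT₂⟩ := exists_isPartialTriv_Icc hq hab'
  -- the retraction of the line onto `[a, b]`
  let r : ℝ → ℝ := fun x => (projIcc a b hab.le x : ℝ)
  have hrc : Continuous r := continuous_subtype_val.comp continuous_projIcc
  have hrmem : ∀ x, r x ∈ Icc a b := fun x => (projIcc a b hab.le x).2
  have hrid : ∀ x ∈ Icc a b, r x = x := fun x hx => by
    show ((projIcc a b hab.le x : ℝ)) = x
    rw [projIcc_of_mem hab.le hx]
  -- the corrected chart and fibre coordinate
  let Φ' : ℝ × F → E := fun z => Φ₂ (z.1, Ψ₂ (Φ (r z.1, z.2)))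
  let Ψ' : E → F := fun y => Ψ (Φ₂ (r (q y), Ψ₂ y))
  refine ⟨(Φ', Ψ'), ⟨?_, ?_, ?_, ?_, ?_⟩, ?_, ?_⟩
  · -- continuity of `Φ'` on `[a', b'] × F`
    have h1 : ContinuousOn (fun z : ℝ × F => Φ (r z.1, z.2)) (Icc a' b' ×ˢ univ) :=
      hT.continuousOn_chart.comp ((hrc.comp continuous_fst).prodMk continuous_snd).continuousOn
        fun z _ => ⟨hrmem z.1, mem_univ _⟩
    have h2 : ContinuousOn (fun z : ℝ × F => Ψ₂ (Φ (r z.1, z.2))) (Icc a' b' ×ˢ univ) :=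
      hT₂.continuousOn_coord.comp h1 fun z _ => by
        show q (Φ (r z.1, z.2)) ∈ Icc a' b'
        rw [hT.proj_chart _ (hrmem z.1)]
        exact hsub (hrmem z.1)
    exact hT₂.continuousOn_chart.comp (continuous_fst.continuousOn.prodMk h2)
      fun z hz => ⟨hz.1, mem_univ _⟩
  · -- continuity of `Ψ'` on `q⁻¹ [a', b']`
    have h1 : ContinuousOn (fun y : E => Φ₂ (r (q y), Ψ₂ y)) (q ⁻¹' Icc a' b') :=
      hT₂.continuousOn_chart.comp (((hrc.comp hq.continuous).continuousOn).prodMk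
        hT₂.continuousOn_coord) fun y _ => ⟨hsub (hrmem (q y)), mem_univ _⟩
    exact hT.continuousOn_coord.comp h1 fun y _ => by
      show q (Φ₂ (r (q y), Ψ₂ y)) ∈ Icc a b
      rw [hT₂.proj_chart _ (hsub (hrmem (q y)))]
      exact hrmem (q y)
  · -- `q (Φ' (x, f)) = x`
    intro x hx f
    exact hT₂.proj_chart x hx _
  · -- `Ψ' (Φ' (x, f)) = f`
    intro x hx f
    show Ψ (Φ₂ (r (q (Φ₂ (x, Ψ₂ (Φ (r x, f))))), Ψ₂ (Φ₂ (x, Ψ₂ (Φ (r x, f)))))) = f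
    rw [hT₂.proj_chart x hx, hT₂.coord_chart x hx]
    have h1 : Φ₂ (r x, Ψ₂ (Φ (r x, f))) = Φ (r x, f) := by
      have h2 := hT₂.chart_proj_coord (Φ (r x, f))
        (by rw [hT.proj_chart _ (hrmem x)]; exact hsub (hrmem x))
      rwa [hT.proj_chart _ (hrmem x)] at h2
    rw [h1, hT.coord_chart _ (hrmem x)]
  · -- `Φ' (q y, Ψ' y) = y`
    intro y hy
    show Φ₂ (q y, Ψ₂ (Φ (r (q y), Ψ (Φ₂ (r (q y), Ψ₂ y))))) = y
    have h1 : Φ (r (q y), Ψ (Φ₂ (r (q y), Ψ₂ y))) = Φ₂ (r (q y), Ψ₂ y) := by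
      have h2 := hT.chart_proj_coord (Φ₂ (r (q y), Ψ₂ y))
        (by rw [hT₂.proj_chart _ (hsub (hrmem (q y)))]; exact hrmem (q y))
      rwa [hT₂.proj_chart _ (hsub (hrmem (q y)))] at h2
    rw [h1, hT₂.coord_chart _ (hsub (hrmem (q y))), hT₂.chart_proj_coord y hy]
  · -- agreement of the charts over `[a, b]`
    intro x hx f
    show Φ₂ (x, Ψ₂ (Φ (r x, f))) = Φ (x, f)
    rw [hrid x hx]
    have h2 := hT₂.chart_proj_coord (Φ (x, f)) (by rw [hT.proj_chart x hx]; exact hsub hx)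
    rwa [hT.proj_chart x hx] at h2
  · -- agreement of the fibre coordinates over `q⁻¹ [a, b]`
    intro y hy
    show Ψ (Φ₂ (r (q y), Ψ₂ y)) = Ψ y
    rw [hrid (q y) hy, hT₂.chart_proj_coord y (hsub hy)]

end Partial

/-! ### Exhaustion of the line -/

section Real

variable {E : Type u} {F : Type w} [TopologicalSpace E] [TopologicalSpace F] {q : E → ℝ}

/-- The exhausting compact intervals `Kₙ = [-n-1, n+1]`. [folklore] -/
def exhaustIcc (n : ℕ) : Set ℝ := Icc (-(n : ℝ) - 1) (n + 1)

/-- Unfolding `exhaustIcc`. [folklore] -/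
theorem exhaustIcc_def (n : ℕ) : exhaustIcc n = Icc (-(n : ℝ) - 1) (n + 1) := rfl

/-- The exhausting intervals increase. [folklore] -/
theorem exhaustIcc_mono {m n : ℕ} (h : m ≤ n) : exhaustIcc m ⊆ exhaustIcc n := by
  have h' : (m : ℝ) ≤ n := Nat.cast_le.2 h
  exact Icc_subset_Icc (by linarith) (by linarith)

/-- `x ∈ Kₙ` as soon as `|x| ≤ n + 1`, in particular for `n = ⌈|x|⌉₊`. [folklore] -/
theorem mem_exhaustIcc_of_abs_le {x : ℝ} {n : ℕ} (h : |x| ≤ n + 1) : x ∈ exhaustIcc n := by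
  rw [abs_le] at h
  exact ⟨by linarith [h.1], h.2⟩

/-- `x ∈ K_{⌈|x|⌉₊}`. [folklore] -/
theorem mem_exhaustIcc_ceil (x : ℝ) : x ∈ exhaustIcc ⌈|x|⌉₊ :=
  mem_exhaustIcc_of_abs_le ((Nat.le_ceil |x|).trans (le_add_of_nonneg_right zero_le_one))

/-- A neighbourhood of `x` inside `K_{⌈|x|⌉₊ + 1}`. [folklore] -/
theorem Ioo_subset_exhaustIcc (x : ℝ) : Ioo (x - 1) (x + 1) ⊆ exhaustIcc (⌈|x|⌉₊ + 1) := by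
  intro y hy
  refine mem_exhaustIcc_of_abs_le ?_
  have h1 : |y| ≤ |x| + 1 := by
    have := abs_sub_abs_le_abs_sub y x
    have h2 : |y - x| ≤ 1 := abs_le.2 ⟨by linarith [hy.1], by linarith [hy.2]⟩
    linarith
  have h2 : |x| ≤ ⌈|x|⌉₊ := Nat.le_ceil |x|
  push_cast
  linarith

variable (hq : IsFibreBundleWith F q) [Nonempty E]

/-- **The tower of partial trivialisations** over `Kₙ = [-n-1, n+1]`, each extending the previous
one (by `exists_isPartialTriv_extend`, chosen). [cite: Steenrod1951, §11.6] -/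
noncomputable def trivTower : (n : ℕ) →
    {T : (ℝ × F → E) × (E → F) // IsPartialTriv q (exhaustIcc n) T.1 T.2}
  | 0 =>
    ⟨((exists_isPartialTriv_Icc hq
        (show (-((0 : ℕ) : ℝ) - 1) < ((0 : ℕ) : ℝ) + 1 by norm_num)).choose,
      (exists_isPartialTriv_Icc hq
        (show (-((0 : ℕ) : ℝ) - 1) < ((0 : ℕ) : ℝ) + 1 by norm_num)).choose_spec.choose),
      (exists_isPartialTriv_Icc hq
        (show (-((0 : ℕ) : ℝ) - 1) < ((0 : ℕ) : ℝ) + 1 by norm_num)).choose_spec.choose_spec⟩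
  | n + 1 =>
    ⟨(exists_isPartialTriv_extend hq (a' := -((n + 1 : ℕ) : ℝ) - 1) (b' := ((n + 1 : ℕ) : ℝ) + 1)
        (show (-(n : ℝ) - 1) < n + 1 by linarith [n.cast_nonneg (α := ℝ)])
        (by push_cast; linarith) (by push_cast; linarith) (trivTower n).2).choose,
      (exists_isPartialTriv_extend hq (a' := -((n + 1 : ℕ) : ℝ) - 1) (b' := ((n + 1 : ℕ) : ℝ) + 1)
        (show (-(n : ℝ) - 1) < n + 1 by linarith [n.cast_nonneg (α := ℝ)])
        (by push_cast; linarith) (by push_cast; linarith) (trivTower n).2).choose_spec.1⟩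

/-- Consecutive stages of the tower agree over the smaller interval. [folklore] -/
theorem trivTower_succ_agree (n : ℕ) :
    (∀ x ∈ exhaustIcc n, ∀ f, (trivTower hq (n + 1)).1.1 (x, f) = (trivTower hq n).1.1 (x, f)) ∧
      ∀ y, q y ∈ exhaustIcc n → (trivTower hq (n + 1)).1.2 y = (trivTower hq n).1.2 y :=
  (exists_isPartialTriv_extend hq (a' := -((n + 1 : ℕ) : ℝ) - 1) (b' := ((n + 1 : ℕ) : ℝ) + 1)
    (show (-(n : ℝ) - 1) < n + 1 by linarith [n.cast_nonneg (α := ℝ)])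
    (by push_cast; linarith) (by push_cast; linarith) (trivTower hq n).2).choose_spec.2

/-- All later stages of the tower agree with stage `m` over `Kₘ`. [folklore] -/
theorem trivTower_agree {m n : ℕ} (hmn : m ≤ n) :
    (∀ x ∈ exhaustIcc m, ∀ f, (trivTower hq n).1.1 (x, f) = (trivTower hq m).1.1 (x, f)) ∧
      ∀ y, q y ∈ exhaustIcc m → (trivTower hq n).1.2 y = (trivTower hq m).1.2 y := by
  induction hmn with
  | refl => exact ⟨fun _ _ _ => rfl, fun _ _ => rfl⟩
  | step hle ih =>
    rename_i k
    obtain ⟨h1, h2⟩ := trivTower_succ_agree hq k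
    refine ⟨fun x hx f => ?_, fun y hy => ?_⟩
    · rw [h1 x (exhaustIcc_mono hle hx) f, ih.1 x hx f]
    · rw [h2 y (exhaustIcc_mono hle hy), ih.2 y hy]

/-- The limit chart `Φ∞ (x, f) = Φ_{⌈|x|⌉} (x, f)`. [folklore] -/
noncomputable def limChart (z : ℝ × F) : E := (trivTower hq ⌈|z.1|⌉₊).1.1 z

/-- The limit fibre coordinate `Ψ∞ y = Ψ_{⌈|q y|⌉} y`. [folklore] -/
noncomputable def limCoord (y : E) : F := (trivTower hq ⌈|q y|⌉₊).1.2 y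

/-- The limit chart is stage `n` wherever stage `n` is defined. [folklore] -/
theorem limChart_eq {n : ℕ} {x : ℝ} (hx : x ∈ exhaustIcc n) (f : F) :
    limChart hq (x, f) = (trivTower hq n).1.1 (x, f) := by
  unfold limChart
  rcases le_total ⌈|x|⌉₊ n with h | h
  · exact ((trivTower_agree hq h).1 x (mem_exhaustIcc_ceil x) f).symm
  · exact (trivTower_agree hq h).1 x hx f

/-- The limit fibre coordinate is stage `n` wherever stage `n` is defined. [folklore] -/
theorem limCoord_eq {n : ℕ} {y : E} (hy : q y ∈ exhaustIcc n) :
    limCoord hq y = (trivTower hq n).1.2 y := by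
  unfold limCoord
  rcases le_total ⌈|q y|⌉₊ n with h | h
  · exact ((trivTower_agree hq h).2 y (mem_exhaustIcc_ceil (q y))).symm
  · exact (trivTower_agree hq h).2 y hy

/-- The limit chart is continuous. [folklore] -/
theorem continuous_limChart : Continuous (limChart hq) := by
  rw [continuous_iff_continuousAt]
  rintro ⟨x, f⟩
  set n := ⌈|x|⌉₊ + 1 with hn
  have hO : Ioo (x - 1) (x + 1) ×ˢ (univ : Set F) ∈ 𝓝 (x, f) :=
    prod_mem_nhds (Ioo_mem_nhds (by linarith) (by linarith)) univ_mem
  have heq : EqOn (limChart hq) (trivTower hq n).1.1 (Ioo (x - 1) (x + 1) ×ˢ univ) := by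
    rintro ⟨x', f'⟩ ⟨hx', -⟩
    exact limChart_eq hq (Ioo_subset_exhaustIcc x hx') f'
  have hc : ContinuousOn (trivTower hq n).1.1 (Ioo (x - 1) (x + 1) ×ˢ univ) :=
    (trivTower hq n).2.continuousOn_chart.mono (prod_mono (Ioo_subset_exhaustIcc x) Subset.rfl)
  exact ((hc.congr heq).continuousAt hO)

/-- The limit fibre coordinate is continuous. [folklore] -/
theorem continuous_limCoord : Continuous (limCoord hq) := by
  rw [continuous_iff_continuousAt]
  intro y
  set n := ⌈|q y|⌉₊ + 1 with hn
  have hO : q ⁻¹' Ioo (q y - 1) (q y + 1) ∈ 𝓝 y :=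
    hq.continuous.continuousAt.preimage_mem_nhds (Ioo_mem_nhds (by linarith) (by linarith))
  have heq : EqOn (limCoord hq) (trivTower hq n).1.2 (q ⁻¹' Ioo (q y - 1) (q y + 1)) :=
    fun y' hy' => limCoord_eq hq (Ioo_subset_exhaustIcc (q y) hy')
  have hc : ContinuousOn (trivTower hq n).1.2 (q ⁻¹' Ioo (q y - 1) (q y + 1)) :=
    (trivTower hq n).2.continuousOn_coord.mono (preimage_mono (Ioo_subset_exhaustIcc (q y)))
  exact ((hc.congr heq).continuousAt hO)

omit [Nonempty E] in
/-- **A fibre bundle over the real line is trivial**: there is a homeomorphism `E ≃ₜ ℝ × F` over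
`ℝ`. [cite: Steenrod1951, §11.6] [cite: HusemollerFibreBundles1994, Ch. 4, Cor. 10.3] -/
theorem exists_homeomorph_prod_of_real (hq : IsFibreBundleWith F q) :
    ∃ e : E ≃ₜ ℝ × F, ∀ y, (e y).1 = q y := by
  rcases isEmpty_or_nonempty E with hE | hE
  · haveI : IsEmpty F := ⟨fun f => by
      obtain ⟨g⟩ := hq.nonempty_fibre_homeomorph 0
      exact isEmptyElim (g.symm f)⟩
    exact ⟨{ toEquiv := Equiv.equivOfIsEmpty E (ℝ × F)
             continuous_toFun := continuous_of_const fun y => isEmptyElim y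
             continuous_invFun := continuous_of_const fun y => isEmptyElim y.2 },
      fun y => isEmptyElim y⟩
  refine ⟨{ toFun := fun y => (q y, limCoord hq y)
            invFun := limChart hq
            left_inv := fun y => ?_
            right_inv := fun z => ?_
            continuous_toFun := hq.continuous.prodMk (continuous_limCoord hq)
            continuous_invFun := continuous_limChart hq }, fun y => rfl⟩
  · -- `Φ∞ (q y, Ψ∞ y) = y`
    have hy := mem_exhaustIcc_ceil (q y)
    show limChart hq (q y, limCoord hq y) = y
    rw [limChart_eq hq hy, limCoord_eq hq hy]
    exact (trivTower hq _).2.chart_proj_coord y hy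
  · -- `(q (Φ∞ z), Ψ∞ (Φ∞ z)) = z`
    obtain ⟨x, f⟩ := z
    have hx := mem_exhaustIcc_ceil x
    have hq' : q (limChart hq (x, f)) = x := by
      rw [limChart_eq hq hx]
      exact (trivTower hq _).2.proj_chart x hx f
    refine Prod.ext hq' ?_
    show limCoord hq (limChart hq (x, f)) = f
    have hmem : q (limChart hq (x, f)) ∈ exhaustIcc ⌈|x|⌉₊ := by rw [hq']; exact hx
    rw [limCoord_eq hq hmem, limChart_eq hq hx]
    exact (trivTower hq _).2.coord_chart x hx f

end Real

/-! ### Bases homeomorphic to the line; open intervals -/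

section Interval

variable {E : Type u} {B : Type v} {F : Type w} [TopologicalSpace E] [TopologicalSpace B]
  [TopologicalSpace F] {p : E → B}

/-- **A fibre bundle over a base homeomorphic to `ℝ` is trivial.** [cite: Steenrod1951, §11.6] -/
theorem exists_homeomorph_prod_of_homeomorph_real (h : IsFibreBundleWith F p) (β : B ≃ₜ ℝ) :
    ∃ e : E ≃ₜ B × F, ∀ y, (e y).1 = p y := by
  obtain ⟨e, he⟩ := exists_homeomorph_prod_of_real (h.comp_homeomorph_base β)
  refine ⟨e.trans (β.symm.prodCongr (Homeomorph.refl F)), fun y => ?_⟩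
  show β.symm (e y).1 = p y
  rw [he]
  exact β.symm_apply_apply (p y)

/-- The increasing affine homeomorphism between two open intervals. [folklore] -/
def iooAffineHomeomorph {a b c d : ℝ} (hab : a < b) (hcd : c < d) : Ioo a b ≃ₜ Ioo c d where
  toFun x := ⟨c + (x - a) / (b - a) * (d - c), by
    obtain ⟨h1, h2⟩ := x.2
    have hba : 0 < b - a := by linarith
    have hdc : 0 < d - c := by linarith
    have h3 : 0 < (x - a) / (b - a) := div_pos (by linarith) hba
    have h4 : (x - a) / (b - a) < 1 := by rw [div_lt_one hba]; linarith
    constructor <;> nlinarith⟩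
  invFun y := ⟨a + (y - c) / (d - c) * (b - a), by
    obtain ⟨h1, h2⟩ := y.2
    have hba : 0 < b - a := by linarith
    have hdc : 0 < d - c := by linarith
    have h3 : 0 < (y - c) / (d - c) := div_pos (by linarith) hdc
    have h4 : (y - c) / (d - c) < 1 := by rw [div_lt_one hdc]; linarith
    constructor <;> nlinarith⟩
  left_inv x := by
    apply Subtype.ext
    have hba : b - a ≠ 0 := by linarith
    have hdc : d - c ≠ 0 := by linarith
    show a + (c + (x - a) / (b - a) * (d - c) - c) / (d - c) * (b - a) = x
    field_simp
    ring
  right_inv y := by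
    apply Subtype.ext
    have hba : b - a ≠ 0 := by linarith
    have hdc : d - c ≠ 0 := by linarith
    show c + (a + (y - c) / (d - c) * (b - a) - a) / (b - a) * (d - c) = y
    field_simp
    ring
  continuous_toFun := by
    refine Continuous.subtype_mk ?_ _
    exact continuous_const.add (((continuous_subtype_val.sub continuous_const).div_const _).mul
      continuous_const)
  continuous_invFun := by
    refine Continuous.subtype_mk ?_ _
    exact continuous_const.add (((continuous_subtype_val.sub continuous_const).div_const _).mul
      continuous_const)

/-- An open interval is homeomorphic to the line (`tan` after an affine change of variable).
[folklore] -/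
def iooHomeomorphReal {a b : ℝ} (hab : a < b) : Ioo a b ≃ₜ ℝ :=
  (iooAffineHomeomorph hab (show -(Real.pi / 2) < Real.pi / 2 by linarith [Real.pi_pos])).trans
    Real.tanOrderIso.toHomeomorph

/-- **A fibre bundle over an open interval is trivial**: for `p : E → (a, b)` a fibre bundle with
fibre `F` there is `E ≃ₜ (a, b) × F` over the base. [cite: Steenrod1951, §11.6]
[cite: HusemollerFibreBundles1994, Ch. 4, Cor. 10.3] -/
theorem exists_homeomorph_prod_of_Ioo {a b : ℝ} (hab : a < b) {p : E → Ioo a b}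
    (h : IsFibreBundleWith F p) : ∃ e : E ≃ₜ Ioo a b × F, ∀ y, (e y).1 = p y :=
  exists_homeomorph_prod_of_homeomorph_real h (iooHomeomorphReal hab)

/-- **A fibre bundle over an open half-line is trivial**: for `p : E → (a, ∞)` a fibre bundle with
fibre `F` there is `E ≃ₜ (a, ∞) × F` over the base (`(a, ∞) ≃ₜ (0, ∞) ≃ₜ ℝ` by translation and
`log`). [cite: Steenrod1951, §11.6] [cite: HusemollerFibreBundles1994, Ch. 4, Cor. 10.3] -/
theorem exists_homeomorph_prod_of_Ioi (a : ℝ) {p : E → Ioi a} (h : IsFibreBundleWith F p) :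
    ∃ e : E ≃ₜ Ioi a × F, ∀ y, (e y).1 = p y := by
  have hto : ∀ x : Ioi a, (x : ℝ) - a ∈ Ioi (0 : ℝ) := fun x => by
    have hx : a < x := x.2
    show (0 : ℝ) < x - a
    linarith
  have hinv : ∀ y : Ioi (0 : ℝ), (y : ℝ) + a ∈ Ioi a := fun y => by
    have hy : (0 : ℝ) < y := y.2
    show a < y + a
    linarith
  let eqv : Ioi a ≃ Ioi (0 : ℝ) :=
    ⟨fun x => ⟨x - a, hto x⟩, fun y => ⟨y + a, hinv y⟩,
      fun x => Subtype.ext (show (x : ℝ) - a + a = x by ring),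
      fun y => Subtype.ext (show (y : ℝ) + a - a = y by ring)⟩
  let τ : Ioi a ≃ₜ Ioi (0 : ℝ) :=
    Homeomorph.mk eqv ((continuous_subtype_val.sub continuous_const).subtype_mk _)
      ((continuous_subtype_val.add continuous_const).subtype_mk _)
  exact exists_homeomorph_prod_of_homeomorph_real h (τ.trans Real.expOrderIso.symm.toHomeomorph)

end Interval

end IsFibreBundleWith

end Literature.AlgebraicTopology.Homotopy

end
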